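import Literature.Barriers.CriticalPhenomena.GaussianDominationRouteDiagramsProp74
import Literature.Barriers.CriticalPhenomena.GaussianDominationRouteProp83OfProp74
import HarnessLib

/-!
# Discharges of named facts of `GaussianDominationRouteBootstrap.lean`

`Literature/Barriers/CriticalPhenomena/GaussianDominationRouteBootstrapHolds.lean` —
proofs-only sibling of `GaussianDominationRouteBootstrap.lean` (no definitions, no named
facts). Each theorem below closes a named fact `X : Prop` of that file as `X_holds : X` by
composing an ACCEPTED reduction theorem of the tree with the ACCEPTED unconditional `_holds`
discharges of all of its hypotheses; nothing is re-proved and no statement is changed.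
Recorded by the librarian sweep g25 (2026-08-16, pass 5c: facts dischargeable in one line from
the tree's own lemmas), so that the facts census, `#h21_route_deps` and the cone guardrail see
these facts as theorems.

Discharged here:

* `HvdH2017_prop88_holds` := `HvdH2017_prop88_of_prop74` `HvdH2017_prop74_holds`
  (`GaussianDominationRouteProp83OfProp74.lean`).
* `HvdH2017_prop810_holds` := `HvdH2017_prop810_of_prop74` `HvdH2017_prop74_holds`
  (`GaussianDominationRouteProp83OfProp74.lean`).

## References

* [HaraSlade1990] — see `lean/references.bib` and the docstring of the fact in `GaussianDominationRouteBootstrap.lean`.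
* [HeydenreichVanDerHofstad2017] — see `lean/references.bib` and the docstring of the fact in `GaussianDominationRouteBootstrap.lean`.
-/

namespace Literature.Barriers.CriticalPhenomena

/-- **Discharge of the named fact `HvdH2017_prop88`** (`GaussianDominationRouteBootstrap.lean`):
NAMED FACT (derived node) — Prop. 8.8, "Successful application of the bootstrap": … — obtained
as `HvdH2017_prop88_of_prop74` applied to the tree's unconditional discharge
`HvdH2017_prop74_holds` of its hypothesis (reduction in
`GaussianDominationRouteProp83OfProp74.lean`).
[cite: HeydenreichVanDerHofstad2017, Prop. 8.8]
[cite: HaraSlade1990, §4.1 (p. 369: "Therefore P₃ holds")] -/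
theorem HvdH2017_prop88_holds :
    HvdH2017_prop88 :=
  HvdH2017_prop88_of_prop74 HvdH2017_prop74_holds

/-- **Discharge of the named fact `HvdH2017_prop810`** (`GaussianDominationRouteBootstrap.lean`):
NAMED FACT (open node, the core of the lace expansion) — Prop. 8.10, "Improvement of the
bounds": "If the assumptions of Prop. … — obtained as `HvdH2017_prop810_of_prop74` applied to
the tree's unconditional discharge `HvdH2017_prop74_holds` of its hypothesis (reduction in
`GaussianDominationRouteProp83OfProp74.lean`).
[cite: HeydenreichVanDerHofstad2017, Prop. 8.10 (with Prop. 8.3, Lemmas 8.11–8.12) and p. 108]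
[cite: HaraSlade1990, Prop. 4.3 and Lemma 4.5] -/
theorem HvdH2017_prop810_holds :
    HvdH2017_prop810 :=
  HvdH2017_prop810_of_prop74 HvdH2017_prop74_holds

end Literature.Barriers.CriticalPhenomena
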